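import Summits.HubbardSuperconductivity.HubbardSuperconductivity.Theorems.AnisotropyChordTransferFibre3Hole2Bond

/-!
# Route `AnisotropyChord` / H0 rotor rung: HOLE₂(.75) channel checks — kernel facts for `37 ≤ L ≤ 45`

KERNEL FACTS (zero data): for each listed `L` the per-`L` channel checker `Hole2.chanCheck L` (`…Fibre3Hole2Bond`: g3's parameter
check + the enclosures of the three torus Green values `G̃_{g_L}(0,0), G̃_{g_L}(2,0), G̃_{g_L}(1,1)` by g3's `greenIv`, and the two
integer comparisons `2aKer(2,0) ≤ 1`, `4aKer(1,1) − 2aKer(2,0) ≤ 1` in walk units) returns `true`, by one `decide +kernel` each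
(`O(L²)` interval operations; `maxHeartbeats 400000` pre-budgeted as in g3's per-`L` files).  Soundness
(`Hole2.twoHoleGap_of_chanCheck : chanCheck L = true → TwoHoleGap L (3/4·eps1 L)`) is `…Fibre3Hole2Chan`; the ∀`L ≥ 9` assembly is
`…Fibre3Hole2AllL` (`9…36`: g3's kernel certificates; `37…63`: these facts; `≥ 64`: analytic, `…Fibre3Hole2Large`).
Prover seat `hubbard-h0-rotor-p3` g4; helper for stmt-HubbardSuperconductivity-19089 (`--supports`, helper class).
WHAT THIS IS NOT: nothing here proves superconductivity in the Hubbard model (rotor TARGET as worded stays FALSE, g15 verdict);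
kernel facts for ONE input (HOLE₂(.75)) of ONE conditional reduction (rung 19089). Tree imports only; no sorry, no `native_decide`.
-/

set_option linter.dupNamespace false
set_option autoImplicit false

namespace Summit.HubbardSuperconductivity.HubbardSuperconductivity.Theorems.AnisotropyChord.Transfer.Fibre3

namespace Hole2

set_option maxHeartbeats 400000 in
/-- kernel fact: the channel check passes at `L = 37` (`2aKer(2,0) ≤ 1`, `4aKer(1,1) − 2aKer(2,0) ≤ 1` at `g_37 ≥ ¾ε₁(37)`). [folklore] -/
theorem chanCheck_37 : chanCheck 37 = true := by
  decide +kernel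

set_option maxHeartbeats 400000 in
/-- kernel fact: the channel check passes at `L = 38` (`2aKer(2,0) ≤ 1`, `4aKer(1,1) − 2aKer(2,0) ≤ 1` at `g_38 ≥ ¾ε₁(38)`). [folklore] -/
theorem chanCheck_38 : chanCheck 38 = true := by
  decide +kernel

set_option maxHeartbeats 400000 in
/-- kernel fact: the channel check passes at `L = 39` (`2aKer(2,0) ≤ 1`, `4aKer(1,1) − 2aKer(2,0) ≤ 1` at `g_39 ≥ ¾ε₁(39)`). [folklore] -/
theorem chanCheck_39 : chanCheck 39 = true := by
  decide +kernel

set_option maxHeartbeats 400000 in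
/-- kernel fact: the channel check passes at `L = 40` (`2aKer(2,0) ≤ 1`, `4aKer(1,1) − 2aKer(2,0) ≤ 1` at `g_40 ≥ ¾ε₁(40)`). [folklore] -/
theorem chanCheck_40 : chanCheck 40 = true := by
  decide +kernel

set_option maxHeartbeats 400000 in
/-- kernel fact: the channel check passes at `L = 41` (`2aKer(2,0) ≤ 1`, `4aKer(1,1) − 2aKer(2,0) ≤ 1` at `g_41 ≥ ¾ε₁(41)`). [folklore] -/
theorem chanCheck_41 : chanCheck 41 = true := by
  decide +kernel

set_option maxHeartbeats 400000 in
/-- kernel fact: the channel check passes at `L = 42` (`2aKer(2,0) ≤ 1`, `4aKer(1,1) − 2aKer(2,0) ≤ 1` at `g_42 ≥ ¾ε₁(42)`). [folklore] -/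
theorem chanCheck_42 : chanCheck 42 = true := by
  decide +kernel

set_option maxHeartbeats 400000 in
/-- kernel fact: the channel check passes at `L = 43` (`2aKer(2,0) ≤ 1`, `4aKer(1,1) − 2aKer(2,0) ≤ 1` at `g_43 ≥ ¾ε₁(43)`). [folklore] -/
theorem chanCheck_43 : chanCheck 43 = true := by
  decide +kernel

set_option maxHeartbeats 400000 in
/-- kernel fact: the channel check passes at `L = 44` (`2aKer(2,0) ≤ 1`, `4aKer(1,1) − 2aKer(2,0) ≤ 1` at `g_44 ≥ ¾ε₁(44)`). [folklore] -/
theorem chanCheck_44 : chanCheck 44 = true := by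
  decide +kernel

set_option maxHeartbeats 400000 in
/-- kernel fact: the channel check passes at `L = 45` (`2aKer(2,0) ≤ 1`, `4aKer(1,1) − 2aKer(2,0) ≤ 1` at `g_45 ≥ ¾ε₁(45)`). [folklore] -/
theorem chanCheck_45 : chanCheck 45 = true := by
  decide +kernel

end Hole2

end Summit.HubbardSuperconductivity.HubbardSuperconductivity.Theorems.AnisotropyChord.Transfer.Fibre3
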